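import HarnessLib
import Summits.RiemannHypothesis.RiemannHypothesis.Theorems.WeilFormatCDataA1TabValid1
import Summits.RiemannHypothesis.RiemannHypothesis.Theorems.WeilFormatCDataA1TabValidK2
import Summits.RiemannHypothesis.RiemannHypothesis.Theorems.WeilFormatCDataA1TabValidK3
import Summits.RiemannHypothesis.RiemannHypothesis.Theorems.WeilFormatCDataA1TabValidK4
import Summits.Ventures.WeilGRH.TwistedGramCellCheckCK
import Summits.Ventures.WeilGRH.TwistedGramCellConsts
import Literature.NumberTheory.LFunctions.WeilExplicitDirichletConj
import Summits.Ventures.WeilGRH.KCellsMod11OneBData1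

/-!
SPLIT 2/5 (check-wall / node-memory rule; STAR split — every block file imports only `KCellsMod11OneBData1`, the head imports them all): kernel blocks of cell `c11h4`; the glue, the PSD certificate and the theorems are in `KCellsMod11OneB.lean`.
ENGINE v2 (weil-grh-2 gen15): cell checker `K` (`TwistedGramCellCheckCK`: far rows tabulated once, Schur column sums by ONE Kronecker big-integer product per pair, front door `TwistedEncl.weilPositivityOnChar_of_checkCellK`); the midpoint matrix `D` and the Cholesky factor `L` are carried PACKED (one numeral per row, 64-bit words offset `2^63`, `PsdDyadic.unpackSq` / `unpackTri`) — the statements proved are unchanged.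
# χ-cells mod 11 at `t = 1` (1 even complex class + conjugates): Weil positivity for `L(s, χ)` on `[−1, 1]`

Cell `rh-explicit`, WEIL TRACK — GRH ARM (engine seat weil-grh-2 gen14).  Kernel-checked INSTANCES of the parity-0 complex data door
`weilPositivityOnChar_of_twistedC_formatC_dataJ` (order `J = 1`) via the cell checker's front door `TwistedEncl.weilPositivityOnChar_of_checkCellC`
(`TwistedGramCellCheckC` / `…CDoor`) at the window `a = 1` of the internal `ζ` record `WeilFormatCData.A1` (prime powers `2, 3, 4, 5, 7 < e²`,
`S = 2^256`; table validity below `131` assembled inside each proof from weil-2's kernel facts `tabv26`, `tTF26`, …).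
The character values are general roots of unity (orders not square-root expressible in general), so `χ(k)` enters the cell checker through
kernel-certified BOXES: `Xtabf11b[j] ∋ e(m_j/10) = exp(2πi·m_j/10)` for the exponents `m_j` of `mtabf11b` (`MC.expI` on the table's `π` box, ONE kernel check
`tXf11b`; membership `hXf11b` by `MC.mem_expI`), and `χ(k) = χ(2)^e = exp(2πi·h·e/10)` for `k ≡ 2^e (mod 11)` from the class hypothesis `χ(2) = exp(2πi/10)^h`
(`2` generates `(ℤ/11)ˣ`, order 10; local `apply_eq` in each `hXs…`).  SHARED (tag `f11b`): `LQf11b ∋ log 11`, `CCf11b ∋ a(1+E(2a))`, `AOPf11b ∋ Σ Λ(k)/√k·2cos(π/(n_k+2))`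
(floors `[2, 1, 1, 1, 1]`), the cell shape `df11b` — block `B = 25` (`49 × 49` on `|p| < 25`), Schur columns `25 ≤ |p| < 125`, far weights `wN` (units `2^-40`,
shaved `2^16` below the kernel's `dhatCBoxA` lower bounds), crude floor `d₀` (all depend on `q` only) — and ONE sign check `tSCf11b`.
PER CELL: the five boxes `Xs…` of `χ(2), χ(3), χ(4), χ(5), χ(7)`, tail parameters `θ, η`, dyadic midpoints `D…` (units `2^-60`, radius `ρ`) and the integer
Cholesky factor `L…` of `D − δ` (kernel margin `λ` informative); all 2B−1 rows checked by ONE `checkCellCRows` kernel call (`maxRecDepth 200000`), `PsdDyadic.checkPsdMid`.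
CLASSES: `χ(2) = e(4/10)` (Conrey 11.5 / conj. 11.9, order 5, λ = 0.006).
Final theorems `weilPositivityOnChar_mod11_chi<m>_one (χ : DirichletCharacter ℂ 11) (hχ : χ (2 : ZMod 11) = exp(2πi/10) ^ h) : WeilPositivityOnChar χ 1` and
`…_conj` (the conjugate class `h ↦ 10 − h`, via `WeilPositivityOnChar χ⁻¹ a ↔ WeilPositivityOnChar χ a`).
Pure data + kernel checks + the typed door; RH/GRH-free; standard axioms.  References: H. Yoshida (1992) §§5–7 [Yoshida1992HermitianForms];
R. E. Moore (1966) Ch. 3 [Moore1966]; N. J. Higham (2002) [Higham2002ASNA].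
-/

set_option linter.style.longLine false

noncomputable section

namespace Summit.Ventures.WeilGRH.KCellsMod11OneB
open Literature.NumberTheory.LFunctions Literature.NumberTheory.LFunctions.Yoshida1992 Encl
open Literature.Analysis.ValidatedNumerics.NumericsMP Literature.Analysis.SpecialFunctions
open Summit.RiemannHypothesis.RiemannHypothesis.Theorems.WeilFormatCData.A1
open Summit.Ventures.WeilGRH.TwistedEncl
open scoped Real ComplexConjugate
set_option maxRecDepth 200000 in
/-- cell `c11h4`, rows `12…23`, columns `0…24` (checker `K`): re-computed entries within `ρ·2^-60` of the midpoints (one kernel call). [cite: Moore1966, Ch. 3 (interval arithmetic: inclusion property)] -/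
theorem tK12x0c11h4 : checkCellKBlock (2 ^ 256) C (Xsc11h4.map MC.re) (Xsc11h4.map MC.im) LQf11b tab df11b ec11h4 60 2 (PsdDyadic.unpackSq 64 49 DPc11h4) 12 12 0 25 = true := by
  set_option maxHeartbeats 0 in decide +kernel
set_option maxRecDepth 200000 in
/-- cell `c11h4`, rows `12…23`, columns `25…48` (checker `K`): re-computed entries within `ρ·2^-60` of the midpoints (one kernel call). [cite: Moore1966, Ch. 3 (interval arithmetic: inclusion property)] -/
theorem tK12x25c11h4 : checkCellKBlock (2 ^ 256) C (Xsc11h4.map MC.re) (Xsc11h4.map MC.im) LQf11b tab df11b ec11h4 60 2 (PsdDyadic.unpackSq 64 49 DPc11h4) 12 12 25 24 = true := by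
  set_option maxHeartbeats 0 in decide +kernel
end Summit.Ventures.WeilGRH.KCellsMod11OneB

end
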